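import Literature.MathematicalPhysics.QuantumLattice.HubbardFermiCurve
import Mathlib.Analysis.SpecialFunctions.Trigonometric.Inverse
import HarnessLib

/-!
# Umklapp kinematics on the square-lattice Fermi curve at every filling below half filling

Topic `Literature/MathematicalPhysics/QuantumLattice`; continues `HubbardFermiCurve.lean`
(`sqDispersion k = -2 (cos k₁ + cos k₂)`; there: for `μ < -2 - √2` the curve lies in `|kᵢ| < π/4`,
which is Benfatto–Giuliani–Mastropietro's "umklapp processes with `n ≤ 4` quasi-particles are not
allowed", Ann. Henri Poincaré 7 (2006) 809, eq. (2.39) and the Remark after it).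

For the whole hole-doped band `-4 < μ < 0` the level curve `{ε = μ} ∩ [-π, π]²` is no longer
small, and momentum conservation at a quartic vertex must be taken modulo `2πℤ²`. This file
records the elementary kinematics of that situation, with constants explicit in `μ`:

* §1 `abs_le_umklappRadius_of_sqDispersion_eq` — every coordinate of a point of the curve has
  `|kᵢ| ≤ K(μ) := arccos (-μ/2 - 1)`; `K(μ) < π` (`μ < 0`), and `K(μ) < π/2` iff `μ < -2`;
* §2 `abs_add_abs_lt_pi_of_sqDispersion_eq` — the curve lies in the OPEN diamond `|k₁| + |k₂| < π`;
* §3 reciprocal vectors `2π n` reachable by momenta of the curve, `Σⱼ kⱼ = 2π n`: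
  `2|nᵢ| < m` for `m` legs (`two_mul_abs_lt_of_sum_eq`), so `|nᵢ| ≤ 1` at a quartic vertex
  (`natAbs_le_one_of_sum_eq`); never a diagonal vector for `m ≤ 4` legs
  (`eq_zero_or_eq_zero_of_sum_eq`); and `n = 0` at a quartic vertex when `μ < -2`
  (`eq_zero_of_sum_eq_of_lt_neg_two`);
* §4 **Cooper-disjointness** (`umklapp_cooper_disjoint`): if `n ≠ 0` at a quartic vertex, EVERY
  pair sum `kⱼ + kⱼ'` (`j ≠ j'`) has a coordinate of modulus `≥ 2 (π - K(μ)) > 0`: an umklapp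
  quadruple stays a fixed distance away from the Cooper configuration `kⱼ' = -kⱼ`.

Everything is PROVED; the only definition is the abbreviation `umklappRadius μ = arccos (-μ/2 - 1)`.
[folklore] elementary trigonometry; the `μ < -2 - √2` statement it complements is BGM 2006 (2.39).

## Sources

G. Benfatto, A. Giuliani, V. Mastropietro, Ann. Henri Poincaré 7 (2006) 809–898, eq. (2.39) and the
Remark following it; §2.5, remark after (2.76) (`BenfattoGiulianiMastropietro2006`).
-/

noncomputable section

open Real Finset

namespace Literature.MathematicalPhysics.QuantumLattice

/-! ### §1 Coordinates of the level curve -/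

/-- The coordinate radius of the level curve `{ε = μ}`: `K(μ) = arccos (-μ/2 - 1)`
(BGM 2006, Remark after (2.39): the coordinate of a point of the curve is at most this). [folklore] -/
def umklappRadius (μ : ℝ) : ℝ := Real.arccos (-μ / 2 - 1)

/-- `0 ≤ K(μ)`. [folklore] -/
theorem umklappRadius_nonneg (μ : ℝ) : 0 ≤ umklappRadius μ := Real.arccos_nonneg _

/-- `K(μ) < π` for `μ < 0`. [folklore] -/
theorem umklappRadius_lt_pi {μ : ℝ} (hμ : μ < 0) : umklappRadius μ < π := by
  unfold umklappRadius
  have h : Real.arccos (-μ / 2 - 1) ≠ π := by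
    rw [Ne, Real.arccos_eq_pi]
    push Not; linarith
  exact lt_of_le_of_ne (Real.arccos_le_pi _) h

/-- `K(μ) < π/2` for `-4 ≤ μ < -2`: then four momenta of the curve cannot reach a reciprocal vector. [folklore] -/
theorem umklappRadius_lt_pi_div_two {μ : ℝ} (hμ₁ : -4 ≤ μ) (hμ₂ : μ < -2) : umklappRadius μ < π / 2 := by
  unfold umklappRadius
  rw [← Real.arccos_zero]
  exact Real.arccos_lt_arccos (by norm_num) (by linarith : (0 : ℝ) < -μ / 2 - 1) (by linarith)

/-- `π/2 ≤ K(μ)` for `-2 ≤ μ`. [folklore] -/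
theorem pi_div_two_le_umklappRadius {μ : ℝ} (hμ : -2 ≤ μ) : π / 2 ≤ umklappRadius μ := by
  unfold umklappRadius
  rw [← Real.arccos_zero]
  exact Real.antitone_arccos (by linarith : -μ / 2 - 1 ≤ 0)

/-- From `c ≤ cos a` and `|a| ≤ π`: `|a| ≤ arccos c`. [folklore] -/
theorem abs_le_arccos_of_le_cos {a c : ℝ} (ha : |a| ≤ π) (h : c ≤ Real.cos a) : |a| ≤ Real.arccos c := by
  have h1 : Real.arccos (Real.cos |a|) = |a| := Real.arccos_cos (abs_nonneg a) ha
  rw [← h1, Real.cos_abs]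
  exact Real.antitone_arccos h

/-- **Every coordinate of a point of the level curve `{ε = μ}` (fundamental domain `|kᵢ| ≤ π`)
satisfies `|kᵢ| ≤ K(μ) = arccos (-μ/2 - 1)`**: `cos kᵢ = -μ/2 - cos k_{1-i} ≥ -μ/2 - 1`.
(BGM 2006, Remark after (2.39), stated there for small filling.) [cite: BenfattoGiulianiMastropietro2006, Remark after (2.39)] -/
theorem abs_le_umklappRadius_of_sqDispersion_eq {μ : ℝ} {k : Fin 2 → ℝ} (hk : ∀ i, |k i| ≤ π)
    (he : sqDispersion k = μ) (i : Fin 2) : |k i| ≤ umklappRadius μ := by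
  have h0 := Real.cos_le_one (k 0); have h1 := Real.cos_le_one (k 1)
  unfold sqDispersion at he
  refine abs_le_arccos_of_le_cos (hk i) ?_
  fin_cases i
  · show -μ / 2 - 1 ≤ Real.cos (k 0); linarith
  · show -μ / 2 - 1 ≤ Real.cos (k 1); linarith

/-- In particular the level curve misses the boundary of the fundamental domain: `|kᵢ| < π`
for `μ < 0`. [folklore] -/
theorem abs_lt_pi_of_sqDispersion_eq {μ : ℝ} (hμ : μ < 0) {k : Fin 2 → ℝ} (hk : ∀ i, |k i| ≤ π)
    (he : sqDispersion k = μ) (i : Fin 2) : |k i| < π :=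
  (abs_le_umklappRadius_of_sqDispersion_eq hk he i).trans_lt (umklappRadius_lt_pi hμ)

/-- Reflecting coordinates does not change the dispersion (`cos` is even). [folklore] -/
theorem sqDispersion_reflect (σ : Fin 2 → ℝ) (hσ : ∀ i, σ i = 1 ∨ σ i = -1) (k : Fin 2 → ℝ) :
    sqDispersion (fun i => σ i * k i) = sqDispersion k := by
  have hc : ∀ i, Real.cos (σ i * k i) = Real.cos (k i) := by
    intro i
    rcases hσ i with h | h
    · rw [h, one_mul]
    · rw [h, neg_one_mul, Real.cos_neg]
  unfold sqDispersion
  rw [hc 0, hc 1]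

/-! ### §2 The level curve lies in the open diamond -/

/-- **The level curve `{ε = μ}`, `μ < 0`, lies in the open diamond `|k₁| + |k₂| < π`**:
if `|k₁| + |k₂| ≥ π` then `cos k₂ ≤ cos (π - |k₁|) = -cos k₁`, so `cos k₁ + cos k₂ ≤ 0 < -μ/2`. [folklore] -/
theorem abs_add_abs_lt_pi_of_sqDispersion_eq {μ : ℝ} (hμ : μ < 0) {k : Fin 2 → ℝ} (hk : ∀ i, |k i| ≤ π)
    (he : sqDispersion k = μ) : |k 0| + |k 1| < π := by
  by_contra hge
  push Not at hge
  unfold sqDispersion at he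
  have hsum : 0 < Real.cos (k 0) + Real.cos (k 1) := by linarith
  -- `cos |k 1| ≤ cos (π - |k 0|) = - cos |k 0|`
  have hle : Real.cos |k 1| ≤ Real.cos (π - |k 0|) :=
    Real.cos_le_cos_of_nonneg_of_le_pi (by linarith [abs_nonneg (k 0), hk 0]) (hk 1) (by linarith)
  rw [Real.cos_pi_sub, Real.cos_abs, Real.cos_abs] at hle
  linarith

/-! ### §3 Reciprocal vectors reachable by momenta of the curve -/

section Reciprocal

variable {μ : ℝ} {m : ℕ} {k : Fin m → Fin 2 → ℝ}

/-- The coordinate sum of `m` momenta of the curve is at most `m · K(μ)` in modulus. [folklore] -/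
theorem abs_sum_le_mul_umklappRadius (hk : ∀ j i, |k j i| ≤ π) (he : ∀ j, sqDispersion (k j) = μ)
    (i : Fin 2) : |∑ j, k j i| ≤ m * umklappRadius μ := by
  calc |∑ j, k j i| ≤ ∑ j, |k j i| := abs_sum_le_sum_abs _ _
    _ ≤ ∑ _j : Fin m, umklappRadius μ :=
        sum_le_sum fun j _ => abs_le_umklappRadius_of_sqDispersion_eq (hk j) (he j) i
    _ = m * umklappRadius μ := by simp

/-- **Reachable reciprocal vectors, coordinatewise**: if `m ≥ 1` momenta of the curve (`μ < 0`)
sum to `2π n`, then `2 |nᵢ| < m`. [folklore] -/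
theorem two_mul_abs_lt_of_sum_eq (hμ : μ < 0) (hm : 0 < m) (hk : ∀ j i, |k j i| ≤ π)
    (he : ∀ j, sqDispersion (k j) = μ) {n : Fin 2 → ℤ} (hsum : ∀ i, ∑ j, k j i = 2 * π * n i)
    (i : Fin 2) : 2 * |(n i : ℝ)| < m := by
  have h1 := abs_sum_le_mul_umklappRadius hk he i
  rw [hsum i, abs_mul, abs_mul, abs_two, abs_of_pos Real.pi_pos] at h1
  have h2 : (m : ℝ) * umklappRadius μ < m * π :=
    mul_lt_mul_of_pos_left (umklappRadius_lt_pi hμ) (by exact_mod_cast hm)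
  nlinarith [Real.pi_pos, abs_nonneg (n i : ℝ)]

/-- At a quartic vertex only `|nᵢ| ≤ 1` is reachable. [folklore] -/
theorem natAbs_le_one_of_sum_eq (hμ : μ < 0) {k : Fin 4 → Fin 2 → ℝ} (hk : ∀ j i, |k j i| ≤ π)
    (he : ∀ j, sqDispersion (k j) = μ) {n : Fin 2 → ℤ} (hsum : ∀ i, ∑ j, k j i = 2 * π * n i)
    (i : Fin 2) : (n i).natAbs ≤ 1 := by
  have h := two_mul_abs_lt_of_sum_eq hμ (by norm_num) hk he hsum i
  have h' : |(n i : ℝ)| < 2 := by push_cast at h; linarith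
  rw [← Int.cast_abs] at h'
  have h'' : |n i| < 2 := by exact_mod_cast h'
  have h3 := abs_lt.1 h''
  omega

/-- The positive-quadrant case of `eq_zero_or_eq_zero_of_sum_eq`: `m ≤ 4` momenta of the curve
cannot sum to `2π n` with `n₁, n₂ ≥ 1` (each leg has `kⱼ₁ + kⱼ₂ < π`). [folklore] -/
theorem not_sum_eq_of_pos (hμ : μ < 0) (hm : m ≤ 4) (hk : ∀ j i, |k j i| ≤ π)
    (he : ∀ j, sqDispersion (k j) = μ) {n : Fin 2 → ℤ} (hsum : ∀ i, ∑ j, k j i = 2 * π * n i)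
    (h0 : 0 < n 0) (h1 : 0 < n 1) : False := by
  have hleg : ∀ j, k j 0 + k j 1 < π := by
    intro j
    have hd := abs_add_abs_lt_pi_of_sqDispersion_eq hμ (hk j) (he j)
    linarith [le_abs_self (k j 0), le_abs_self (k j 1)]
  have hval : ∑ j, (k j 0 + k j 1) = 2 * π * ((n 0 : ℝ) + n 1) := by
    rw [sum_add_distrib, hsum 0, hsum 1]; ring
  have hge0 : (1 : ℝ) ≤ n 0 := by exact_mod_cast h0
  have hge1 : (1 : ℝ) ≤ n 1 := by exact_mod_cast h1
  have hm' : (m : ℝ) ≤ 4 := by exact_mod_cast hm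
  rcases Nat.eq_zero_or_pos m with rfl | hmpos
  · have h00 : ∑ j : Fin 0, (k j 0 + k j 1) = 0 := by simp
    rw [h00] at hval
    nlinarith [Real.pi_pos]
  · have hlt : ∑ j, (k j 0 + k j 1) < m * π := by
      calc ∑ j, (k j 0 + k j 1) < ∑ _j : Fin m, π :=
            sum_lt_sum_of_nonempty ⟨⟨0, hmpos⟩, mem_univ _⟩ fun j _ => hleg j
        _ = m * π := by simp
    rw [hval] at hlt
    nlinarith [Real.pi_pos]

/-- **No diagonal reciprocal vector**: if `m ≤ 4` momenta of the curve (`μ < 0`) sum to `2π n`,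
then `n₁ = 0 ∨ n₂ = 0` — the curve lies in the open diamond, so `± kⱼ₁ ± kⱼ₂ < π` for each leg,
while `n₁ n₂ ≠ 0` would need a signed sum `≥ 4π` (reduce to `n₁, n₂ > 0` by reflecting
coordinates). [folklore] -/
theorem eq_zero_or_eq_zero_of_sum_eq (hμ : μ < 0) (hm : m ≤ 4) (hk : ∀ j i, |k j i| ≤ π)
    (he : ∀ j, sqDispersion (k j) = μ) {n : Fin 2 → ℤ} (hsum : ∀ i, ∑ j, k j i = 2 * π * n i) :
    n 0 = 0 ∨ n 1 = 0 := by
  by_contra h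
  push Not at h
  obtain ⟨h0, h1⟩ := h
  -- signs making both components positive
  let σZ : Fin 2 → ℤ := fun i => if 0 < n i then 1 else -1
  let σ : Fin 2 → ℝ := fun i => (σZ i : ℝ)
  have hσ : ∀ i, σ i = 1 ∨ σ i = -1 := by
    intro i
    simp only [σ, σZ]
    split_ifs <;> simp
  have hσabs : ∀ i (x : ℝ), |σ i * x| = |x| := by
    intro i x
    rcases hσ i with h | h <;> simp [h]
  have hne : ∀ i, n i ≠ 0 := by
    intro i; fin_cases i
    · exact h0
    · exact h1
  have hpos : ∀ i, 0 < σZ i * n i := by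
    intro i
    simp only [σZ]
    split_ifs with hp
    · simpa using hp
    · have : n i < 0 := lt_of_le_of_ne (not_lt.1 hp) (hne i)
      nlinarith
  refine not_sum_eq_of_pos (k := fun j i => σ i * k j i) (n := fun i => σZ i * n i) hμ hm
    (fun j i => by rw [hσabs]; exact hk j i) (fun j => by rw [sqDispersion_reflect σ hσ]; exact he j)
    (fun i => ?_) (hpos 0) (hpos 1)
  show ∑ j, σ i * k j i = 2 * π * ((σZ i * n i : ℤ) : ℝ)
  rw [← mul_sum, hsum i]; push_cast; ring

/-- **No four-leg umklapp for `μ < -2`** (`K(μ) < π/2`, so `|Σⱼ kⱼᵢ| < 2π`): four momenta of the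
curve summing to a reciprocal vector sum to zero. (For `μ < -2 - √2` even eight legs cannot, BGM 2006
(2.39); at `μ = -2` the quadruple `kⱼ = (π/2, 0)` reaches `(2π, 0)`.) [cite: BenfattoGiulianiMastropietro2006, eq. (2.39)] -/
theorem eq_zero_of_sum_eq_of_lt_neg_two (hμ₁ : -4 < μ) (hμ₂ : μ < -2) {k : Fin 4 → Fin 2 → ℝ}
    (hk : ∀ j i, |k j i| ≤ π) (he : ∀ j, sqDispersion (k j) = μ) {n : Fin 2 → ℤ}
    (hsum : ∀ i, ∑ j, k j i = 2 * π * n i) : n = 0 := by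
  funext i
  have h1 := abs_sum_le_mul_umklappRadius hk he i
  rw [hsum i, abs_mul, abs_mul, abs_two, abs_of_pos Real.pi_pos] at h1
  have h2 := umklappRadius_lt_pi_div_two hμ₁.le hμ₂
  have h3 : |(n i : ℝ)| < 1 := by push_cast at h1; nlinarith [Real.pi_pos, abs_nonneg (n i : ℝ)]
  rw [← Int.cast_abs] at h3
  have h4 : |n i| < 1 := by exact_mod_cast h3
  simpa using Int.abs_lt_one_iff.1 h4

end Reciprocal

/-! ### §4 Cooper-disjointness of umklapp quadruples -/

/-- **Umklapp quadruples never feed the Cooper channel.** On the level curve `{ε = μ}`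
(fundamental domain `|kᵢ| ≤ π`): if four momenta sum to a NON-ZERO reciprocal vector `2π n`, then
every pair sum `kⱼ + kⱼ'`, `j ≠ j'`, has a coordinate of modulus at least `2 (π - K(μ))`,
`K(μ) = arccos (-μ/2 - 1)` (positive for `μ < 0`, `umklapp_cooper_gap_pos`) — the two complementary
legs carry at most `2 K(μ)` of the `2π |nᵢ| ≥ 2π` in a coordinate `i` with `nᵢ ≠ 0`. So umklapp
configurations are bounded away from the Cooper configuration `kⱼ' = -kⱼ`. [folklore] -/
theorem umklapp_cooper_disjoint {μ : ℝ}
    {k : Fin 4 → Fin 2 → ℝ} (hk : ∀ j i, |k j i| ≤ π)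
    (he : ∀ j, sqDispersion (k j) = μ) {n : Fin 2 → ℤ} (hn : n ≠ 0)
    (hsum : ∀ i, ∑ j, k j i = 2 * π * n i) {j j' : Fin 4} (hjj : j ≠ j') :
    ∃ i, 2 * (π - umklappRadius μ) ≤ |k j i + k j' i| := by
  -- a coordinate with `n i ≠ 0`
  obtain ⟨i, hi⟩ : ∃ i, n i ≠ 0 := by
    by_contra h; push Not at h; exact hn (funext h)
  refine ⟨i, ?_⟩
  have hK : ∀ l, |k l i| ≤ umklappRadius μ := fun l =>
    abs_le_umklappRadius_of_sqDispersion_eq (hk l) (he l) i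
  -- split the sum over `Fin 4` into `{j, j'}` and the rest
  have hsplit : ∑ l, k l i = (k j i + k j' i) + ∑ l ∈ (univ \ {j, j'}), k l i := by
    rw [← sum_sdiff (subset_univ {j, j'}), sum_pair hjj]; ring
  have hrest : |∑ l ∈ (univ \ {j, j'}), k l i| ≤ 2 * umklappRadius μ := by
    have hcard : (univ \ ({j, j'} : Finset (Fin 4))).card = 2 := by
      rw [card_sdiff_of_subset (subset_univ _), card_univ, Fintype.card_fin, card_pair hjj]
    calc |∑ l ∈ (univ \ {j, j'}), k l i| ≤ ∑ l ∈ (univ \ {j, j'}), |k l i| := abs_sum_le_sum_abs _ _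
      _ ≤ ∑ _l ∈ (univ \ {j, j'}), umklappRadius μ := sum_le_sum fun l _ => hK l
      _ = 2 * umklappRadius μ := by rw [sum_const, hcard]; simp
  have hni : (1 : ℝ) ≤ |(n i : ℝ)| := by
    rw [← Int.cast_abs]; exact_mod_cast Int.one_le_abs hi
  -- `|k j i + k j' i| ≥ |2π n i| - |rest| ≥ 2π - 2K`
  have htri : |(2 * π * n i : ℝ)| ≤ |k j i + k j' i| + |∑ l ∈ (univ \ {j, j'}), k l i| := by
    rw [← hsum i, hsplit]; exact abs_add_le _ _
  rw [abs_mul, abs_mul, abs_two, abs_of_pos Real.pi_pos] at htri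
  nlinarith [Real.pi_pos, abs_nonneg (k j i + k j' i)]

/-- The separation constant is positive: `0 < 2 (π - K(μ))` for `μ < 0`. [folklore] -/
theorem umklapp_cooper_gap_pos {μ : ℝ} (hμ : μ < 0) : 0 < 2 * (π - umklappRadius μ) := by
  have := umklappRadius_lt_pi hμ; linarith

end Literature.MathematicalPhysics.QuantumLattice

end
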